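import Summits.Ventures.Crystal3D.Theorems.StickyWulffConstantTextureLiminfTexShadowLevelReach
import HarnessLib

/-!
# The PREDECESSOR INVARIANT of the word automaton is legal (level reach: how to read the relaunch term)
# (lane T, crux `TextureLiminfV5`, stmt-Ventures-23912, registered stub `stub_terraceCensus`; (β) terrace census, LevelReach — count half)

HONEST FRAMING. Venture `Summits/Ventures/Crystal3D` (cell `crystal3d-full`), route `route-Ventures-StickyWulffConstant`, helper `--supports`
the law-v5 crux `TextureLiminfV5` (stmt-Ventures-23912), lane T, mechanism (β).  Three elementary lemmas about lane F's word automaton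
(…CoaxialWallLawEndRowDefs / …WordInstance); census-free, certificate-free; nothing about energies is asserted; F-C1 not moved.

THE POINT.  `word_family_endPairs_launch` (…TexShadowLevelReach) / `word_endPairs_multi_launch` (…LevelReachMulti) carry a user-chosen STATE
INVARIANT `P` preserved by the legal moves (`hPstraight`, `hPcross`) and report the invariant at the arriving state of every RELAUNCH.  The
automaton's certified states always have their ball AND their predecessor `b − F κ (u κ)` in `X`; this file records that this «predecessor
invariant» is itself a legal invariant, so that a consumer may conjoin it to any invariant of his and READ IT OFF the relaunch term: a straight
relaunch into a launch ball `p` then needs `p − 2·F [] (u [])  ∈ X`, a cancelling-pair relaunch from the class `[μ]` needs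
`p − F [] (u []) − F [μ] (u [μ]) ∈ X` — e.g. for the (β) ledger's MIRROR launches `p = r + A′w` at a twin reading `r` (…LevelLedgerEventsStar)
the straight case is void, since `r − A′w` lies in the empty far cap of the reading.
* `predInv_straight` — `b ∈ X ∧ b − d ∈ X`, `b` FULL / TWIN-gliding / NARROW along `d = F κ (u κ)` ⇒ `b + d ∈ X ∧ (b + d) − d ∈ X`;
* `predInv_cross` — the same across a CROSS along a reading normal `m` (`⟪d, m⟫ = √(2/3)`): the target `b + F (next κ m) (u (next κ m))` is the
  mirror ball of the slot `−u κ`, hence in `X`;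
* `predInv_and_straight` / `predInv_and_cross` — the hypotheses `hPstraight` / `hPcross` of the launch census for the conjunction
  `(b ∈ X ∧ b − F κ (u κ) ∈ X) ∧ P₁ (b, κ)`, from the same hypotheses for `P₁`.
WHAT THIS IS NOT: any bound on the relaunch term; F-C1 not moved.
-/

noncomputable section

namespace Summit.Ventures.Crystal3D.Theorems

open Summit.Ventures.Crystal3D Finset
open scoped InnerProductSpace

section PredInv

variable {X : Finset (EuclideanSpace ℝ (Fin 3))} {ver : WordVersion}
  {F : List (EuclideanSpace ℝ (Fin 3)) → (EuclideanSpace ℝ (Fin 3) ≃ₗᵢ[ℝ] EuclideanSpace ℝ (Fin 3))}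
  {u : List (EuclideanSpace ℝ (Fin 3)) → EuclideanSpace ℝ (Fin 3)}
  {WF : List (EuclideanSpace ℝ (Fin 3)) → Prop}
  {next : List (EuclideanSpace ℝ (Fin 3)) → EuclideanSpace ℝ (Fin 3) → List (EuclideanSpace ℝ (Fin 3))}

/-- **The predecessor invariant survives a STRAIGHT legal move**: if `b ∈ X`, `b − F κ (u κ) ∈ X` and `b` is FULL, TWIN-gliding
(`⟪F κ (u κ), m⟫ = 0`) or NARROW along `F κ (u κ)`, then the target `b + F κ (u κ)` is in `X` and its predecessor is `b ∈ X`. -/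
theorem predInv_straight (hu : ∀ κ, u κ ∈ fccSlots) {b : EuclideanSpace ℝ (Fin 3)} {κ : List (EuclideanSpace ℝ (Fin 3))}
    (hmv : IsFull X (F κ) b ∨ (∃ m, IsTwinReading X (F κ) m b ∧ ⟪F κ (u κ), m⟫_ℝ = 0) ∨
      (ver = WordVersion.v2 ∧ IsNarrow X (F κ) (F κ (u κ)) b))
    (hb : b ∈ X ∧ b - F κ (u κ) ∈ X) :
    b + F κ (u κ) ∈ X ∧ b + F κ (u κ) - F κ (u κ) ∈ X := by
  refine ⟨?_, by rw [add_sub_cancel_right]; exact hb.1⟩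
  rcases hmv with hfull | ⟨m, htd, h0⟩ | ⟨-, hnar⟩
  · exact hfull _ (hu κ)
  · exact htd.2.1 _ (hu κ) h0.le
  · exact hnar.1

/-- **The predecessor invariant survives a CROSS move**: at a twin reading `b` of `(F κ, m)` crossed by the direction
(`⟪F κ (u κ), m⟫ = √(2/3)`), the target `b + F (next κ m) (u (next κ m))` of the cross move is the MIRROR BALL of the slot `−u κ`, hence in
`X`, and its predecessor along the new direction is `b ∈ X`. -/
theorem predInv_cross (hFc : ∀ μ κ, F (μ :: κ) = ((ℝ ∙ μ)ᗮ.reflection).trans (F κ))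
    (hu : ∀ κ, u κ ∈ fccSlots) (huc : ∀ μ κ, u (μ :: κ) = -u κ)
    (hWFc : ∀ μ κ, WF (μ :: κ) ↔ (WF κ ∧ ‖μ‖ = 1 ∧
      (∀ w ∈ fccSlots, ⟪w, μ⟫_ℝ = 0 ∨ ⟪w, μ⟫_ℝ = Real.sqrt (2 / 3) ∨ ⟪w, μ⟫_ℝ = -Real.sqrt (2 / 3)) ∧
      ⟪u κ, μ⟫_ℝ = Real.sqrt (2 / 3) ∧ ∀ μ' κ', κ = μ' :: κ' → μ' ≠ -μ))
    (hnext_pop : ∀ μ κ' (m : EuclideanSpace ℝ (Fin 3)), (F (μ :: κ')).symm m = -μ → next (μ :: κ') m = κ')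
    (hnext_push : ∀ κ (m : EuclideanSpace ℝ (Fin 3)), (∀ μ κ', κ = μ :: κ' → (F κ).symm m ≠ -μ) →
      next κ m = (F κ).symm m :: κ)
    {b : EuclideanSpace ℝ (Fin 3)} {κ : List (EuclideanSpace ℝ (Fin 3))} {m : EuclideanSpace ℝ (Fin 3)} (hκ : WF κ)
    (htd : IsTwinReading X (F κ) m b) (hdm : ⟪F κ (u κ), m⟫_ℝ = Real.sqrt (2 / 3)) (hb : b ∈ X ∧ b - F κ (u κ) ∈ X) :
    b + F (next κ m) (u (next κ m)) ∈ X ∧ b + F (next κ m) (u (next κ m)) - F (next κ m) (u (next κ m)) ∈ X := by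
  refine ⟨?_, by rw [add_sub_cancel_right]; exact hb.1⟩
  have hr : 0 < Real.sqrt (2 / 3) := Real.sqrt_pos.2 (by norm_num)
  obtain ⟨-, hfr, -, -⟩ := word_next_spec hFc huc hWFc hnext_pop hnext_push hκ htd.1.1 htd.1.2 hdm
  -- the new direction is `−(d − 2⟪d, m⟫ m)`
  have hdir : F (next κ m) (u (next κ m)) = F κ (-u κ) - (2 * ⟪F κ (-u κ), m⟫_ℝ) • m := by
    rw [hfr, word_u_next huc hnext_pop hnext_push, map_neg, inner_neg_left]
  -- the slot `−u κ` is on the near side, so its mirror site is occupied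
  have hneg : ⟪F κ (-u κ), m⟫_ℝ < 0 := by rw [map_neg, inner_neg_left, hdm]; linarith
  rw [hdir]
  exact htd.2.2.1 (-u κ) (neg_mem_fccSlots (hu κ)) hneg

/-- **`hPstraight` for the conjunction with the predecessor invariant.**  If `P₁` is preserved by straight legal moves (the hypothesis
`hPstraight` of `word_family_endPairs_launch` for `P₁`), so is `fun v => (v.1 ∈ X ∧ v.1 − F v.2 (u v.2) ∈ X) ∧ P₁ v`. -/
theorem predInv_and_straight (hu : ∀ κ, u κ ∈ fccSlots)
    {P₁ : EuclideanSpace ℝ (Fin 3) × List (EuclideanSpace ℝ (Fin 3)) → Prop}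
    (hP₁ : ∀ (b : EuclideanSpace ℝ (Fin 3)) (κ : List (EuclideanSpace ℝ (Fin 3))), WF κ →
      (IsFull X (F κ) b ∨ (∃ m, IsTwinReading X (F κ) m b ∧ ⟪F κ (u κ), m⟫_ℝ = 0) ∨
        (ver = WordVersion.v2 ∧ IsNarrow X (F κ) (F κ (u κ)) b)) →
      P₁ (b, κ) → P₁ (b + F κ (u κ), κ)) :
    ∀ (b : EuclideanSpace ℝ (Fin 3)) (κ : List (EuclideanSpace ℝ (Fin 3))), WF κ →
      (IsFull X (F κ) b ∨ (∃ m, IsTwinReading X (F κ) m b ∧ ⟪F κ (u κ), m⟫_ℝ = 0) ∨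
        (ver = WordVersion.v2 ∧ IsNarrow X (F κ) (F κ (u κ)) b)) →
      ((b ∈ X ∧ b - F κ (u κ) ∈ X) ∧ P₁ (b, κ)) →
      ((b + F κ (u κ) ∈ X ∧ b + F κ (u κ) - F κ (u κ) ∈ X) ∧ P₁ (b + F κ (u κ), κ)) :=
  fun b κ hκ hmv hP => ⟨predInv_straight (ver := ver) hu hmv hP.1, hP₁ b κ hκ hmv hP.2⟩

/-- **`hPcross` for the conjunction with the predecessor invariant.**  If `P₁` is preserved by cross moves (the hypothesis `hPcross` of
`word_family_endPairs_launch` for `P₁`), so is `fun v => (v.1 ∈ X ∧ v.1 − F v.2 (u v.2) ∈ X) ∧ P₁ v`. -/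
theorem predInv_and_cross (hFc : ∀ μ κ, F (μ :: κ) = ((ℝ ∙ μ)ᗮ.reflection).trans (F κ))
    (hu : ∀ κ, u κ ∈ fccSlots) (huc : ∀ μ κ, u (μ :: κ) = -u κ)
    (hWFc : ∀ μ κ, WF (μ :: κ) ↔ (WF κ ∧ ‖μ‖ = 1 ∧
      (∀ w ∈ fccSlots, ⟪w, μ⟫_ℝ = 0 ∨ ⟪w, μ⟫_ℝ = Real.sqrt (2 / 3) ∨ ⟪w, μ⟫_ℝ = -Real.sqrt (2 / 3)) ∧
      ⟪u κ, μ⟫_ℝ = Real.sqrt (2 / 3) ∧ ∀ μ' κ', κ = μ' :: κ' → μ' ≠ -μ))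
    (hnext_pop : ∀ μ κ' (m : EuclideanSpace ℝ (Fin 3)), (F (μ :: κ')).symm m = -μ → next (μ :: κ') m = κ')
    (hnext_push : ∀ κ (m : EuclideanSpace ℝ (Fin 3)), (∀ μ κ', κ = μ :: κ' → (F κ).symm m ≠ -μ) →
      next κ m = (F κ).symm m :: κ)
    {P₁ : EuclideanSpace ℝ (Fin 3) × List (EuclideanSpace ℝ (Fin 3)) → Prop}
    (hP₁ : ∀ (b : EuclideanSpace ℝ (Fin 3)) (κ : List (EuclideanSpace ℝ (Fin 3))) (m : EuclideanSpace ℝ (Fin 3)),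
      WF κ → WF (next κ m) → IsTwinReading X (F κ) m b → ⟪F κ (u κ), m⟫_ℝ = Real.sqrt (2 / 3) →
      P₁ (b, κ) → P₁ (b + F (next κ m) (u (next κ m)), next κ m)) :
    ∀ (b : EuclideanSpace ℝ (Fin 3)) (κ : List (EuclideanSpace ℝ (Fin 3))) (m : EuclideanSpace ℝ (Fin 3)),
      WF κ → WF (next κ m) → IsTwinReading X (F κ) m b → ⟪F κ (u κ), m⟫_ℝ = Real.sqrt (2 / 3) →
      ((b ∈ X ∧ b - F κ (u κ) ∈ X) ∧ P₁ (b, κ)) →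
      ((b + F (next κ m) (u (next κ m)) ∈ X ∧
          b + F (next κ m) (u (next κ m)) - F (next κ m) (u (next κ m)) ∈ X) ∧
        P₁ (b + F (next κ m) (u (next κ m)), next κ m)) :=
  fun b κ m hκ hκ' htd hdm hP =>
    ⟨predInv_cross hFc hu huc hWFc hnext_pop hnext_push hκ htd hdm hP.1, hP₁ b κ m hκ hκ' htd hdm hP.2⟩

end PredInv

end Summit.Ventures.Crystal3D.Theorems

end
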